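import Summits.CriticalPhenomena.PercolationContinuityZ3.Theorems.FK.FKEdgeCountCLT
import Summits.CriticalPhenomena.PercolationContinuityZ3.Theorems.FK.WeakMixingTranslates
import Summits.CriticalPhenomena.PercolationContinuityZ3.Theorems.FK.TranslationAveragesFK
import HarnessLib

/-!
# CENTRAL LIMIT THEOREM FOR THE NUMBER OF OCCURRENCES OF AN INCREASING LOCAL PATTERN UNDER THE RANDOM-CLUSTER
# MEASURE `φ^b_{p,q}` BELOW `p_c(q)` (`d ≥ 2`, `q ≥ 1`): `(N_n(E) − E N_n(E))/√|Λ_n| ⇒ N(0, σ²_E)`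

Claimed R42 (8)(c) in the cell INBOX at 2026-08-28T13:56:48Z by fkp-10a gen 354 (NEW CLAIM #2 of the gen), addressed to coordinator fk-4 g274 (seated 13:10Z 2026-08-28 by l.8389; R151 l.8390: row FO-10a-g354 [g274, R151] = package g354-newmanclt, its (κ) SPENT by l.8399 — hence a new ruling); lineage row FO-10a-g354x (self-suggested), package g354-cltextras, label PV-C.
Helper file of the `fk-continuity` build cell (bschramm lane; `--supports stmt-CriticalPhenomena-4575`); builds on
p205010 (kernel theorem, internal audit signed; external expert review pending). No definitions, no named facts, no
sorries; standard axioms. UNCONDITIONAL.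

Let `E` be an INCREASING event determined by a finite set `F ⊆ E(Λ_k)` of edges (a "local pattern": e.g. "all edges
of a given finite figure are open", "`0 ↔ x` inside `Λ_k`"), and `T_z ω = ω − z` the translation of configurations
(`BondConfig.relabel (sym2Equiv (Site.shift (−z)))`). The field `X_z = 1_E ∘ T_z = 1{the pattern occurs at z}` is
bounded, increasing and translation covariant under the box limits `φ^b_{p,q}` (Grimmett Thm. (4.19)(b)), and
`N_n(E) = Σ_{z∈Λ_n} X_z` counts the occurrences of the pattern in `Λ_n`. Below `p_c(q)` the translation mixing with
exponential rate (tree: `exists_exp_translate_mixing_of_lt_rcCriticalProb`, Alexander's weak mixing (1.1) via DRT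
sharpness) makes `γ_E(z) = Cov(1_E, 1_E ∘ T_z)` summable, so Newman's theorem (`NewmanCLT.tendstoInDistribution_boxSum`)
applies:

* `covariance_pattern_eq` — (B): `Cov(X_x, X_y) = γ_E(y − x)`;
* `exists_abs_patternCov_le`, `summable_patternCov` — (D): `|γ_E(z)| ≤ 4(|F|+1)e^{c(2k+1)}·e^{−c‖z‖_∞}`, summable;
* `tendsto_charFun_patternCount`, `tendstoInDistribution_patternCount` — the CLT for `N_n(E)` under `φ^b_{p,q}`,
  `0 ≤ p < p_c(q)`, both `b`, with variance `σ²_E = Σ_z Cov_{φ^b}(1_E, 1_E ∘ T_z) ∈ [0,∞)`.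

The coordinate-edge count of `FKEdgeCountCLT` is the sum over `i < d` of the patterns `E = {e_{0,i} open}`; this file
treats one arbitrary increasing local pattern (sums of patterns go the same way).

## References

* C. M. Newman, *Normal fluctuations and the FKG inequalities*, Comm. Math. Phys. 74 (1980) 119–128, Thm. 2.
  [Newman1980]
* G. Grimmett, *The Random-Cluster Model*, Springer 2006, Thm. (4.17)(b), Thm. (4.19)(b), Cor. (4.23). [Grimmett2006]
* K. S. Alexander, *On weak mixing in lattice models*, PTRF 110 (1998) 441–471, (1.1). [Alexander1998]
-/

noncomputable section

namespace Summit.CriticalPhenomena.PercolationContinuityZ3.Theorems.FK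

namespace NewmanCLT

open MeasureTheory ProbabilityTheory Complex Finset Filter Topology
open Literature.Probability.Percolation Literature.Probability.LatticeModels Literature.Barriers.CriticalPhenomena
open BoundaryInfluence

variable {d : ℕ} {p q : ℝ}

/-! ### The pattern field `X_z = 1_E ∘ T_z` -/

/-- The occurrence indicator of a measurable pattern at `z` is measurable. [folklore] -/
theorem measurable_patternAt {E : Set (BondConfig (Site d))} (hE : MeasurableSet E) (z : Site d) :
    Measurable fun ω : BondConfig (Site d) =>
      E.indicator (1 : BondConfig (Site d) → ℝ) (BondConfig.relabel (sym2Equiv (Site.shift (-z))) ω) :=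
  (measurable_const.indicator hE).comp (BondConfig.relabel (sym2Equiv (Site.shift (-z)))).measurable

/-- The occurrence indicator of an INCREASING pattern is increasing in the configuration. [cite: Grimmett2006, §2.1] -/
theorem monotone_patternAt {E : Set (BondConfig (Site d))} (hEup : IsUpperSet E) (z : Site d) :
    Monotone fun ω : BondConfig (Site d) =>
      E.indicator (1 : BondConfig (Site d) → ℝ) (BondConfig.relabel (sym2Equiv (Site.shift (-z))) ω) := by
  intro ω ω' hle
  dsimp only
  have hle' := BondConfig.relabel_mono (sym2Equiv (Site.shift (-z))) hle
  by_cases h : BondConfig.relabel (sym2Equiv (Site.shift (-z))) ω ∈ E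
  · have h' : BondConfig.relabel (sym2Equiv (Site.shift (-z))) ω' ∈ E := hEup hle' h
    rw [Set.indicator_of_mem h, Set.indicator_of_mem h', Pi.one_apply, Pi.one_apply]
  · rw [Set.indicator_of_notMem h]
    exact Set.indicator_nonneg (fun _ _ => zero_le_one) _

/-- `|X_z| ≤ 1`. [folklore] -/
theorem abs_patternAt_le (E : Set (BondConfig (Site d))) (z : Site d) (ω : BondConfig (Site d)) :
    |E.indicator (1 : BondConfig (Site d) → ℝ) (BondConfig.relabel (sym2Equiv (Site.shift (-z))) ω)| ≤ (1 : ℕ) := by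
  rw [Nat.cast_one]; exact abs_indicator_one_le_one _ _

/-! ### (B) Translation covariance -/

/-- **(B)**: `Cov_{φ^b}(X_x, X_y) = Cov_{φ^b}(1_E, 1_E ∘ T_{y−x})` for the pattern field of a measurable `E`
(`T_{y−x} ∘ T_x = T_y`, and `φ^b` is `T_x`-invariant, Grimmett Thm. (4.19)(b)). [cite: Grimmett2006, Thm. (4.19)(b)] -/
theorem covariance_pattern_eq (b : Bool) (hp : p ∈ Set.Icc (0 : ℝ) 1) (hq : 1 ≤ q) {E : Set (BondConfig (Site d))}
    (hE : MeasurableSet E) (x y : Site d) :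
    cov[fun ω => E.indicator (1 : BondConfig (Site d) → ℝ) (BondConfig.relabel (sym2Equiv (Site.shift (-x))) ω),
      fun ω => E.indicator (1 : BondConfig (Site d) → ℝ) (BondConfig.relabel (sym2Equiv (Site.shift (-y))) ω);
        rcLimit d b p q] =
    cov[E.indicator (1 : BondConfig (Site d) → ℝ),
      fun ω => E.indicator (1 : BondConfig (Site d) → ℝ) (BondConfig.relabel (sym2Equiv (Site.shift (-(y - x)))) ω);
        rcLimit d b p q] := by
  have hT := (isBoxLimit_rcLimit b hp hq).measurePreserving_relabel_shift hp hq (-x)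
  have hm1 : Measurable (E.indicator (1 : BondConfig (Site d) → ℝ)) := measurable_const.indicator hE
  conv_rhs => rw [← hT.map_eq]
  rw [covariance_map_fun hm1.aestronglyMeasurable (measurable_patternAt hE _).aestronglyMeasurable
    hT.measurable.aemeasurable]
  simp_rw [relabel_shift_neg_relabel_shift_neg_apply, add_sub_cancel]

/-! ### (D) Summable pattern covariances below `p_c(q)` -/

/-- **Exponential decay of the pattern autocovariance below `p_c(q)`**: for an event `E` determined by
`F ⊆ E(Λ_k)` and `0 ≤ p < p_c(q)` (`d ≥ 2`, `q ≥ 1`),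
`|φ^b(E ∩ T_z⁻¹E) − φ^b(E)φ^b(T_z⁻¹E)| ≤ 4(|F|+1)e^{c(2k+1)}·e^{−c‖z‖_∞}` (translation mixing for `‖z‖_∞ > 2k+1`, the
trivial bound otherwise). [cite: Alexander1998, (1.1); Grimmett2006, Cor. (4.23)] -/
theorem exists_abs_patternCov_le (hd : 2 ≤ d) (hq : 1 ≤ q) (hp0 : 0 ≤ p) (hpc : p < rcCriticalProb d q) {k : ℕ}
    {F : Finset (Sym2 (Site d))} (hF : F ⊆ edgesIn (zdGraph d) (box d k)) {E : Set (BondConfig (Site d))}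
    (hE : DeterminedBy E ↑F) :
    ∃ c : ℝ, 0 < c ∧ ∀ (b : Bool) (z : Site d),
      |(rcLimit d b p q).real (E ∩ BondConfig.relabel (sym2Equiv (Site.shift (-z))) ⁻¹' E) -
          (rcLimit d b p q).real E * (rcLimit d b p q).real (BondConfig.relabel (sym2Equiv (Site.shift (-z))) ⁻¹' E)| ≤
        4 * (#F + 1) * Real.exp (c * (2 * k + 1)) * Real.exp (-(c * siteRad z)) := by
  obtain ⟨c, hc, h⟩ := exists_exp_translate_mixing_of_lt_rcCriticalProb hd hq hp0 hpc
  refine ⟨c, hc, fun b z => ?_⟩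
  haveI := isProbabilityMeasure_rcLimit (d := d) b p q
  have hp : p ∈ Set.Icc (0 : ℝ) 1 := ⟨hp0, (hpc.trans (rcCriticalProb_lt_one hd hq)).le⟩
  set P := rcLimit d b p q with hP
  set A := BondConfig.relabel (sym2Equiv (Site.shift (-z))) ⁻¹' E with hA
  have hAE : P.real A = P.real E := by
    rw [measureReal_def, hA, hP, (isBoxLimit_rcLimit b hp hq).measure_preimage_relabel_shift hp hq (-z) E, measureReal_def]
  rw [hAE]
  have htriv : |P.real (E ∩ A) - P.real E * P.real E| ≤ 1 := by
    have h1 : P.real (E ∩ A) ≤ 1 := measureReal_le_one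
    have h2 : P.real E ≤ 1 := measureReal_le_one
    have h4 : 0 ≤ P.real (E ∩ A) := measureReal_nonneg
    have h5 : 0 ≤ P.real E := measureReal_nonneg
    rw [abs_le]; constructor <;> nlinarith
  have hC1 : (1 : ℝ) ≤ 4 * (#F + 1) * Real.exp (c * (2 * k + 1)) * Real.exp (-(c * siteRad z)) ↔
      Real.exp (c * siteRad z) ≤ 4 * (#F + 1) * Real.exp (c * (2 * k + 1)) := by
    rw [Real.exp_neg, ← div_eq_mul_inv, le_div_iff₀ (Real.exp_pos _), one_mul]
  by_cases hm : siteRad z ≤ 2 * k + 1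
  · refine htriv.trans (hC1.2 ?_)
    have h1 : Real.exp (c * siteRad z) ≤ Real.exp (c * (2 * k + 1)) :=
      Real.exp_le_exp.2 (mul_le_mul_of_nonneg_left (by exact_mod_cast hm) hc.le)
    have h2 : (1 : ℝ) ≤ 4 * (#F + 1) := by
      have : (0 : ℝ) ≤ #F := Nat.cast_nonneg _
      linarith
    calc Real.exp (c * siteRad z) ≤ 1 * Real.exp (c * (2 * k + 1)) := by rw [one_mul]; exact h1
      _ ≤ 4 * (#F + 1) * Real.exp (c * (2 * k + 1)) := mul_le_mul_of_nonneg_right h2 (Real.exp_pos _).le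
  · rw [not_le] at hm
    have key := h b hF hF hE hE (v := -z) (by rw [siteRad_neg]; exact_mod_cast hm)
    rw [siteRad_neg] at key
    refine key.trans ?_
    have e : Real.exp (-(c * ((siteRad z : ℝ) - 2 * k - 1))) = Real.exp (c * (2 * k + 1)) * Real.exp (-(c * siteRad z)) := by
      rw [← Real.exp_add]; congr 1; ring
    rw [e]
    have : (4 : ℝ) * #F ≤ 4 * (#F + 1) := by linarith
    have hpos : 0 ≤ Real.exp (c * (2 * k + 1)) * Real.exp (-(c * siteRad z)) := by positivity
    calc 4 * (#F : ℝ) * (Real.exp (c * (2 * k + 1)) * Real.exp (-(c * siteRad z)))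
        ≤ 4 * (#F + 1) * (Real.exp (c * (2 * k + 1)) * Real.exp (-(c * siteRad z))) :=
          mul_le_mul_of_nonneg_right this hpos
      _ = _ := by ring

/-- **(D) below `p_c(q)`**: the pattern autocovariance `z ↦ Cov_{φ^b}(1_E, 1_E ∘ T_z)` is summable over `ℤ^d`.
[cite: Newman1980, Thm. 2 (D); Alexander1998, (1.1)] -/
theorem summable_patternCov (hd : 2 ≤ d) (hq : 1 ≤ q) (hp0 : 0 ≤ p) (hpc : p < rcCriticalProb d q) {k : ℕ}
    {F : Finset (Sym2 (Site d))} (hF : F ⊆ edgesIn (zdGraph d) (box d k)) {E : Set (BondConfig (Site d))}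
    (hE : DeterminedBy E ↑F) (b : Bool) :
    Summable fun z : Site d => cov[E.indicator (1 : BondConfig (Site d) → ℝ),
      fun ω => E.indicator (1 : BondConfig (Site d) → ℝ) (BondConfig.relabel (sym2Equiv (Site.shift (-z))) ω);
        rcLimit d b p q] := by
  obtain ⟨c, hc, h⟩ := exists_abs_patternCov_le hd hq hp0 hpc hF hE
  haveI := isProbabilityMeasure_rcLimit (d := d) b p q
  have hEm : MeasurableSet E := measurableSet_of_isLocalEvent_holds ⟨F, hE⟩
  refine Summable.of_norm_bounded ((summable_exp_neg_mul_siteRad (d := d) hc).mul_left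
    (4 * (#F + 1) * Real.exp (c * (2 * k + 1)))) fun z => ?_
  rw [Real.norm_eq_abs]
  have hAm : MeasurableSet (BondConfig.relabel (sym2Equiv (Site.shift (-z))) ⁻¹' E) :=
    (BondConfig.relabel (sym2Equiv (Site.shift (-z)))).measurable hEm
  have hind : (fun ω => E.indicator (1 : BondConfig (Site d) → ℝ) (BondConfig.relabel (sym2Equiv (Site.shift (-z))) ω)) =
      (BondConfig.relabel (sym2Equiv (Site.shift (-z))) ⁻¹' E).indicator (1 : BondConfig (Site d) → ℝ) := by
    funext ω
    by_cases h : BondConfig.relabel (sym2Equiv (Site.shift (-z))) ω ∈ E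
    · rw [Set.indicator_of_mem h, Set.indicator_of_mem (Set.mem_preimage.2 h), Pi.one_apply, Pi.one_apply]
    · rw [Set.indicator_of_notMem h, Set.indicator_of_notMem (fun h' => h (Set.mem_preimage.1 h'))]
  rw [hind, covariance_indicator_one_eq _ hEm hAm]
  exact h b z

/-! ### The central limit theorem for pattern counts -/

/-- **CLT for the number of occurrences of an increasing local pattern below `p_c(q)`, characteristic-function form**:
for `d ≥ 2`, `q ≥ 1`, `0 ≤ p < p_c(q)`, both `b`, an increasing event `E` determined by `F ⊆ E(Λ_k)`, and every `t`,
with `N_n(ω) = Σ_{z∈Λ_n} 1_E(ω − z)`: `E_{φ^b} exp(it(N_n − E N_n)/√|Λ_n|) → exp(−σ²_E t²/2)`,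
`σ²_E = Σ_z Cov_{φ^b}(1_E, 1_E ∘ T_z)`. [cite: Newman1980, Thm. 2; Grimmett2006, Thm. (4.17)(b), (4.19)(b)] -/
theorem tendsto_charFun_patternCount (hd : 2 ≤ d) (hq : 1 ≤ q) (hp0 : 0 ≤ p) (hpc : p < rcCriticalProb d q) {k : ℕ}
    {F : Finset (Sym2 (Site d))} (hF : F ⊆ edgesIn (zdGraph d) (box d k)) {E : Set (BondConfig (Site d))}
    (hE : DeterminedBy E ↑F) (hEup : IsUpperSet E) (b : Bool) (t : ℝ) :
    Tendsto (fun n : ℕ => ∫ ω, cexp ((((t / Real.sqrt #(box d n)) *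
        (∑ z ∈ box d n, E.indicator (1 : BondConfig (Site d) → ℝ) (BondConfig.relabel (sym2Equiv (Site.shift (-z))) ω) -
          ∫ ω', ∑ z ∈ box d n, E.indicator (1 : BondConfig (Site d) → ℝ)
            (BondConfig.relabel (sym2Equiv (Site.shift (-z))) ω') ∂(rcLimit d b p q)) : ℝ) : ℂ) * I) ∂(rcLimit d b p q))
      atTop (𝓝 ((Real.exp (-((∑' z : Site d, cov[E.indicator (1 : BondConfig (Site d) → ℝ),
        fun ω => E.indicator (1 : BondConfig (Site d) → ℝ) (BondConfig.relabel (sym2Equiv (Site.shift (-z))) ω);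
          rcLimit d b p q]) * t ^ 2 / 2)) : ℝ) : ℂ)) := by
  have hp : p ∈ Set.Icc (0 : ℝ) 1 := ⟨hp0, (hpc.trans (rcCriticalProb_lt_one hd hq)).le⟩
  haveI := isProbabilityMeasure_rcLimit (d := d) b p q
  have hμ : IsPositivelyAssociated (rcLimit d b p q) := isPositivelyAssociated_rcLimit b hp hq
  have hEm : MeasurableSet E := measurableSet_of_isLocalEvent_holds ⟨F, hE⟩
  have hcov : ∀ x y : Site d,
      cov[(fun (z : Site d) (ω : BondConfig (Site d)) => E.indicator (1 : BondConfig (Site d) → ℝ)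
          (BondConfig.relabel (sym2Equiv (Site.shift (-z))) ω)) x,
        (fun (z : Site d) (ω : BondConfig (Site d)) => E.indicator (1 : BondConfig (Site d) → ℝ)
          (BondConfig.relabel (sym2Equiv (Site.shift (-z))) ω)) y; rcLimit d b p q] =
      (fun z : Site d => cov[E.indicator (1 : BondConfig (Site d) → ℝ),
        fun ω => E.indicator (1 : BondConfig (Site d) → ℝ) (BondConfig.relabel (sym2Equiv (Site.shift (-z))) ω);
          rcLimit d b p q]) (y - x) := fun x y => covariance_pattern_eq b hp hq hEm x y
  have hs : Summable (fun z : Site d => cov[E.indicator (1 : BondConfig (Site d) → ℝ),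
        fun ω => E.indicator (1 : BondConfig (Site d) → ℝ) (BondConfig.relabel (sym2Equiv (Site.shift (-z))) ω);
          rcLimit d b p q]) := summable_patternCov hd hq hp0 hpc hF hE b
  exact tendsto_charFun_boxSum (le_trans one_le_two hd) hμ (measurable_patternAt hEm) (monotone_patternAt hEup)
    (Nat.cast_nonneg 1) (abs_patternAt_le E) hcov hs t

/-- **CENTRAL LIMIT THEOREM FOR INCREASING LOCAL PATTERN COUNTS UNDER `φ^b_{p,q}` BELOW `p_c(q)`**: for `d ≥ 2`,
`q ≥ 1`, `0 ≤ p < p_c(q)`, both `b`, and an increasing event `E` determined by finitely many edges `F ⊆ E(Λ_k)`, the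
number `N_n` of translates `z ∈ Λ_n` with `ω − z ∈ E` satisfies `(N_n − E_{φ^b} N_n)/√|Λ_n| → N(0, σ²_E)` in
distribution, `σ²_E = Σ_{z∈ℤ^d} Cov_{φ^b}(1_E, 1_E ∘ T_z)`, for any `Y ~ gaussianReal 0 σ²_E`.
[cite: Newman1980, Thm. 2; Grimmett2006, Thm. (4.17)(b), Thm. (4.19)(b); Alexander1998, (1.1)] -/
theorem tendstoInDistribution_patternCount {Ω' : Type*} {mΩ' : MeasurableSpace Ω'} {P' : Measure Ω'}
    [IsProbabilityMeasure P'] {Y : Ω' → ℝ} (hd : 2 ≤ d) (hq : 1 ≤ q) (hp0 : 0 ≤ p) (hpc : p < rcCriticalProb d q)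
    {k : ℕ} {F : Finset (Sym2 (Site d))} (hF : F ⊆ edgesIn (zdGraph d) (box d k)) {E : Set (BondConfig (Site d))}
    (hE : DeterminedBy E ↑F) (hEup : IsUpperSet E) (b : Bool) {v : NNReal}
    (hv : (v : ℝ) = ∑' z : Site d, cov[E.indicator (1 : BondConfig (Site d) → ℝ),
        fun ω => E.indicator (1 : BondConfig (Site d) → ℝ) (BondConfig.relabel (sym2Equiv (Site.shift (-z))) ω);
          rcLimit d b p q]) (hY : HasLaw Y (gaussianReal 0 v) P') :
    haveI := isProbabilityMeasure_rcLimit (d := d) b p q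
    TendstoInDistribution (fun (n : ℕ) (ω : BondConfig (Site d)) => (Real.sqrt #(box d n))⁻¹ *
        (∑ z ∈ box d n, E.indicator (1 : BondConfig (Site d) → ℝ) (BondConfig.relabel (sym2Equiv (Site.shift (-z))) ω) -
          ∫ ω', ∑ z ∈ box d n, E.indicator (1 : BondConfig (Site d) → ℝ)
            (BondConfig.relabel (sym2Equiv (Site.shift (-z))) ω') ∂(rcLimit d b p q)))
      atTop Y (fun _ => rcLimit d b p q) P' := by
  have hp : p ∈ Set.Icc (0 : ℝ) 1 := ⟨hp0, (hpc.trans (rcCriticalProb_lt_one hd hq)).le⟩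
  haveI := isProbabilityMeasure_rcLimit (d := d) b p q
  have hμ : IsPositivelyAssociated (rcLimit d b p q) := isPositivelyAssociated_rcLimit b hp hq
  have hEm : MeasurableSet E := measurableSet_of_isLocalEvent_holds ⟨F, hE⟩
  have hcov : ∀ x y : Site d,
      cov[(fun (z : Site d) (ω : BondConfig (Site d)) => E.indicator (1 : BondConfig (Site d) → ℝ)
          (BondConfig.relabel (sym2Equiv (Site.shift (-z))) ω)) x,
        (fun (z : Site d) (ω : BondConfig (Site d)) => E.indicator (1 : BondConfig (Site d) → ℝ)
          (BondConfig.relabel (sym2Equiv (Site.shift (-z))) ω)) y; rcLimit d b p q] =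
      (fun z : Site d => cov[E.indicator (1 : BondConfig (Site d) → ℝ),
        fun ω => E.indicator (1 : BondConfig (Site d) → ℝ) (BondConfig.relabel (sym2Equiv (Site.shift (-z))) ω);
          rcLimit d b p q]) (y - x) := fun x y => covariance_pattern_eq b hp hq hEm x y
  have hs : Summable (fun z : Site d => cov[E.indicator (1 : BondConfig (Site d) → ℝ),
        fun ω => E.indicator (1 : BondConfig (Site d) → ℝ) (BondConfig.relabel (sym2Equiv (Site.shift (-z))) ω);
          rcLimit d b p q]) := summable_patternCov hd hq hp0 hpc hF hE b
  exact tendstoInDistribution_boxSum (le_trans one_le_two hd) hμ (measurable_patternAt hEm) (monotone_patternAt hEup)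
    (Nat.cast_nonneg 1) (abs_patternAt_le E) hcov hs hv hY

end NewmanCLT

end Summit.CriticalPhenomena.PercolationContinuityZ3.Theorems.FK
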